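import Literature.RingTheory.GaloisAlgebras.ChaseHarrisonRosenberg
import HarnessLib

/-!
# Galois extensions of commutative rings, II: the torsor isomorphism and points

Continuation of `Literature.RingTheory.GaloisAlgebras.ChaseHarrisonRosenberg` (Greither,
*Cyclic Galois Extensions of Commutative Rings*, LNM 1534, Ch. 0, Thm. 1.6 =
Chase–Harrison–Rosenberg 1965, Thm. 1.3). For a finite group `G` acting **freely** on a
commutative `A`-algebra `B` (for every `g ≠ 1` the `g • b - b` generate the unit ideal) with ring
of invariants `B^G = A ⊆ B` (`Algebra.IsInvariant A B G`, `FaithfulSMul A B`) we prove: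

* `canonicalMap_bijective_of_free`, `canonicalEquiv`: condition (i) of Greither, Thm. 1.6 — the
  canonical map `h : B ⊗_A B → (G → B)`, `x ⊗ y ↦ (x · g(y))_g`, is bijective, i.e. `B ⊇ A` is a
  `G`-Galois extension in the sense of Auslander–Goldman / Chase–Harrison–Rosenberg (Greither,
  Def. 1.5); geometrically `Spec B ×_{Spec A} Spec B ≅ G × Spec B` — `Spec B → Spec A` is a
  `G`-torsor (it is finite locally free by `projective_of_free`, `finite_of_free`);
* `exists_smul_eq_of_algHom`, `smul_eq_self_of_algHom`: for a field `Ω` over `A`, `G` acts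
  simply transitively on the `Ω`-valued points `Hom_{A-alg}(B, Ω)` of `Spec B` over the given
  point of `Spec A` (when there are any) — the form in which the torsor property is used for
  quotients of schemes by free actions of finite groups (Mumford, *Abelian Varieties*, §7,
  Thm. p. 66 and §12; here for the quotient of an abelian variety by a finite subgroup).

Proofs as printed in Greither, proof of Thm. 1.6 (pp. 3–4): with `(x_p, y_p)` as in (ii'), the
inverse of `h` is `(c_g) ↦ ∑_g ∑ₚ c_g g(x_p) ⊗ y_p`; for points, `φ ⊗ ψ : B ⊗_A B → Ω` transported
to `(G → B) → Ω` factors through one projection `g`, whence `ψ = φ ∘ g`.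

## References

* [Greither1992CyclicGalois] C. Greither, *Cyclic Galois Extensions of Commutative Rings*,
  LNM 1534 (1992), Ch. 0, Def. 1.5, Thm. 1.6 (pp. 2–4); held (galaxy panama:519141287002184).
* [ChaseHarrisonRosenberg1965] S. U. Chase, D. K. Harrison, A. Rosenberg, Mem. AMS 52 (1965),
  Thm. 1.3.
* [MumfordAV1970] D. Mumford, *Abelian Varieties* (1970), §7 (Thm. p. 66), §12.
-/

noncomputable section

open scoped TensorProduct

namespace Literature.RingTheory.GaloisAlgebras

variable (A : Type*) {B : Type*} [CommRing A] [CommRing B] [Algebra A B]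
variable (G : Type*) [Group G] [MulSemiringAction G B] [SMulCommClass G A B]

/-! ### (ii') ⇒ (i): the canonical map is bijective -/

section Canonical

variable [Fintype G] [Algebra.IsInvariant A B G] [FaithfulSMul A B]

/-- **The canonical map `h : B ⊗_A B → (G → B)` is bijective** for a free action with
`B^G = A ⊆ B` (Greither, Ch. 0, Thm. 1.6, (iv) ⇒ (i); Chase–Harrison–Rosenberg, Thm. 1.3):
with `(x_p, y_p)` as in (ii'), the inverse is `(c_g)_g ↦ ∑_g ∑ₚ c_g g(x_p) ⊗ y_p`; that it is a
right inverse is the pair of orthogonality relations, that it is a left inverse is the dual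
basis identity after moving `tr(y x_p) ∈ A` across the tensor sign.
[cite: Greither1992CyclicGalois, Ch. 0 Thm. 1.6 (i) (pp. 3–4)] -/
theorem canonicalMap_bijective_of_free
    (hfree : ∀ g : G, g ≠ 1 → Ideal.span (Set.range fun b : B ↦ g • b - b) = ⊤) :
    Function.Bijective (canonicalMap A G (B := B)) := by
  classical
  obtain ⟨s, hs₁, hs⟩ := exists_finset_sum_mul_smul_of_free A G hfree
  -- the candidate inverse
  let k : (G → B) → B ⊗[A] B := fun c ↦ ∑ g : G, ∑ p ∈ s, (c g * g • p.1) ⊗ₜ[A] p.2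
  have hk_add : ∀ c c', k (c + c') = k c + k c' := fun c c' ↦ by
    simp only [k, Pi.add_apply, add_mul, TensorProduct.add_tmul, Finset.sum_add_distrib]
  -- right inverse: the orthogonality relations
  have hright : ∀ c, canonicalMap A G (k c) = c := by
    intro c
    funext h
    have inner : ∀ g : G, ∑ p ∈ s, c g * g • p.1 * h • p.2 =
        c g * g • ∑ p ∈ s, p.1 * (g⁻¹ * h) • p.2 := fun g ↦ by
      rw [Finset.smul_sum, Finset.mul_sum]
      refine Finset.sum_congr rfl fun p _ ↦ ?_
      rw [smul_mul', smul_smul, mul_inv_cancel_left, mul_assoc]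
    calc canonicalMap A G (k c) h = ∑ g : G, ∑ p ∈ s, c g * g • p.1 * h • p.2 := by
          simp only [k, map_sum, Finset.sum_apply, canonicalMap_tmul]
      _ = ∑ g : G, c g * g • ∑ p ∈ s, p.1 * (g⁻¹ * h) • p.2 :=
          Finset.sum_congr rfl fun g _ ↦ inner g
      _ = c h := by
          rw [Fintype.sum_eq_single h]
          · rw [inv_mul_cancel]
            simp_rw [one_smul]
            rw [hs₁, smul_one, mul_one]
          · intro g hg
            rw [hs (g⁻¹ * h) (fun h' ↦ hg (inv_mul_eq_one.mp h')), smul_zero, mul_zero]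
  -- left inverse: the dual basis identity
  have hleft : ∀ t, k (canonicalMap A G t) = t := by
    intro t
    induction t using TensorProduct.induction_on with
    | zero => simp [k]
    | add t t' ht ht' => rw [map_add, hk_add, ht, ht']
    | tmul x y =>
      simp only [k, canonicalMap_tmul]
      rw [Finset.sum_comm]
      calc ∑ p ∈ s, ∑ g : G, (x * g • y * g • p.1) ⊗ₜ[A] p.2
          = ∑ p ∈ s, x ⊗ₜ[A] (trace A G (y * p.1) • p.2) := by
            refine Finset.sum_congr rfl fun p _ ↦ ?_
            rw [← TensorProduct.smul_tmul, trace_smul, Finset.sum_mul, ← TensorProduct.sum_tmul]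
            refine congrArg (· ⊗ₜ[A] p.2) (Finset.sum_congr rfl fun g _ ↦ ?_)
            rw [smul_mul']
            ring
        _ = x ⊗ₜ[A] y := by
            rw [← TensorProduct.tmul_sum]
            simp_rw [trace_smul]
            rw [sum_sum_smul_mul_eq_self' hs₁ hs y]
  exact ⟨fun t t' htt' ↦ by rw [← hleft t, ← hleft t', htt'],
    fun c ↦ ⟨k c, hright c⟩⟩

/-- **The torsor isomorphism** `B ⊗_A B ≃ₐ[A] (G → B)` of a free action with `B^G = A ⊆ B`
(`B ⊇ A` is a `G`-Galois extension, Greither, Ch. 0, Def. 1.5 and Thm. 1.6); geometrically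
`Spec B ×_{Spec A} Spec B ≅ G × Spec B`. [cite: Greither1992CyclicGalois, Ch. 0 Thm. 1.6 (i) (pp. 3–4)] -/
def canonicalEquiv
    (hfree : ∀ g : G, g ≠ 1 → Ideal.span (Set.range fun b : B ↦ g • b - b) = ⊤) :
    B ⊗[A] B ≃ₐ[A] (G → B) :=
  AlgEquiv.ofBijective (canonicalMap A G) (canonicalMap_bijective_of_free A G hfree)

/-- `canonicalEquiv` is the canonical map `h` as an equivalence. [folklore] -/
@[simp]
theorem canonicalEquiv_apply
    (hfree : ∀ g : G, g ≠ 1 → Ideal.span (Set.range fun b : B ↦ g • b - b) = ⊤)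
    (t : B ⊗[A] B) : canonicalEquiv A G hfree t = canonicalMap A G t :=
  AlgEquiv.ofBijective_apply _ _ t

end Canonical

/-! ### Points with values in a field: `G` acts simply transitively on the fibres -/

section Points

variable {Ω : Type*} [Field Ω] [Algebra A Ω]

omit [SMulCommClass G A B] in
/-- **Freeness on points.** If `g` fixes an `Ω`-valued point `φ : B → Ω` of `Spec B`
(`φ (g • b) = φ b` for all `b`) and `G` acts freely, then `g = 1`: otherwise `φ` kills the unit
ideal generated by the `g • b - b`. [cite: Greither1992CyclicGalois, Ch. 0 Thm. 1.6 (iv) (p. 3)] -/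
theorem smul_eq_self_of_algHom
    (hfree : ∀ g : G, g ≠ 1 → Ideal.span (Set.range fun b : B ↦ g • b - b) = ⊤)
    (φ : B →ₐ[A] Ω) {g : G} (hg : ∀ b, φ (g • b) = φ b) : g = 1 := by
  by_contra h
  have hle : Ideal.span (Set.range fun b : B ↦ g • b - b) ≤ RingHom.ker φ.toRingHom := by
    rw [Ideal.span_le]
    rintro _ ⟨b, rfl⟩
    simp [hg b]
  have h1 : (1 : B) ∈ RingHom.ker φ.toRingHom := hle (by rw [hfree g h]; exact Submodule.mem_top)
  simp at h1

variable [Fintype G] [Algebra.IsInvariant A B G] [FaithfulSMul A B]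

omit [Group G] [MulSemiringAction G B] [SMulCommClass G A B] [Algebra.IsInvariant A B G]
  [FaithfulSMul A B] in
/-- An algebra homomorphism from a finite product `G → B` to a field factors through one of the
projections: some `Pi.single g 1` maps to `1`, and then `χ c = χ (Pi.single g (c g))`.
[folklore] -/
theorem exists_eq_single_of_algHom [DecidableEq G] (χ : (G → B) →ₐ[A] Ω) :
    ∃ g : G, ∀ c : G → B, χ c = χ (Pi.single g (c g)) := by
  classical
  -- some idempotent `Pi.single g 1` is not killed
  have hsum : ∑ g : G, χ (Pi.single g 1) = 1 := by
    have h1 : ∑ g : G, (Pi.single g 1 : G → B) = 1 := Finset.univ_sum_single (1 : G → B)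
    rw [← map_sum, h1, map_one]
  obtain ⟨g, -, hg⟩ : ∃ g ∈ (Finset.univ : Finset G), χ (Pi.single g 1) ≠ 0 :=
    Finset.exists_ne_zero_of_sum_ne_zero (hsum.trans_ne one_ne_zero)
  have hidem : χ (Pi.single g 1) * χ (Pi.single g 1) = χ (Pi.single g 1) := by
    rw [← map_mul, ← Pi.single_mul, mul_one]
  have hone : χ (Pi.single g 1) = 1 := by
    have := mul_right_cancel₀ hg (hidem.trans (one_mul _).symm)
    exact this
  refine ⟨g, fun c ↦ ?_⟩
  have hcs : c * Pi.single g 1 = Pi.single g (c g) := by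
    ext h'
    rcases eq_or_ne h' g with rfl | hne
    · simp
    · simp [hne]
  calc χ c = χ c * χ (Pi.single g 1) := by rw [hone, mul_one]
    _ = χ (Pi.single g (c g)) := by rw [← map_mul, hcs]

/-- **Transitivity on points (the fibres of `Spec B → Spec A` are `G`-torsors).** For a free
action with `B^G = A ⊆ B` and two `Ω`-valued points `φ ψ : B → Ω` of `Spec B` over the same
point of `Spec A` (`Ω` a field, both `A`-algebra maps), there is `g ∈ G` with `ψ = φ ∘ g`:
the map `φ ⊗ ψ : B ⊗_A B → Ω` transported along the torsor isomorphism
`B ⊗_A B ≅ (G → B)` factors through a projection `g`, and then `φ x · ψ y = χ_g (x · g(y))`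
gives `ψ y = φ (g y)`. Together with `smul_eq_self_of_algHom`, `G` acts simply transitively on
each non-empty fibre (Chase–Harrison–Rosenberg, Thm. 1.3; cf. Mumford, *Abelian Varieties*,
§7, Thm. p. 66, for quotients of varieties by free finite group actions).
[cite: Greither1992CyclicGalois, Ch. 0 Thm. 1.6 (i) (pp. 3–4)] -/
theorem exists_smul_eq_of_algHom
    (hfree : ∀ g : G, g ≠ 1 → Ideal.span (Set.range fun b : B ↦ g • b - b) = ⊤)
    (φ ψ : B →ₐ[A] Ω) : ∃ g : G, ∀ b, ψ b = φ (g • b) := by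
  classical
  let χ : (G → B) →ₐ[A] Ω :=
    (Algebra.TensorProduct.lift φ ψ (fun x y ↦ Commute.all _ _)).comp
      ((canonicalEquiv A G hfree).symm : (G → B) →ₐ[A] B ⊗[A] B)
  obtain ⟨g, hg⟩ := exists_eq_single_of_algHom A G χ
  have key : ∀ x y : B, φ x * ψ y = χ (Pi.single g (x * g • y)) := by
    intro x y
    have h1 : φ x * ψ y = χ (canonicalMap A G (x ⊗ₜ[A] y)) := by
      change _ = Algebra.TensorProduct.lift φ ψ (fun _ _ ↦ Commute.all _ _)
        ((canonicalEquiv A G hfree).symm (canonicalMap A G (x ⊗ₜ[A] y)))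
      rw [← canonicalEquiv_apply A G hfree, AlgEquiv.symm_apply_apply,
        Algebra.TensorProduct.lift_tmul]
    rw [h1, hg, canonicalMap_tmul]
  have hx : ∀ x, φ x = χ (Pi.single g x) := fun x ↦ by simpa using key x 1
  refine ⟨g, fun b ↦ ?_⟩
  rw [hx]
  simpa using key 1 b

end Points

end Literature.RingTheory.GaloisAlgebras
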